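import Literature.NumberTheory.Automorphic.Zelevinsky1980.InducedMaximalParabolicEndomorphisms
import Literature.NumberTheory.Automorphic.Zelevinsky1980.DetCharInducingDatum
import Literature.NumberTheory.Automorphic.SmoothInductionParabolicNontrivial
import Literature.NumberTheory.Automorphic.Liu2021.LemD1LocalInjectivity
import HarnessLib

/-!
# Rigidity of the inducing character: `Hom_{GL_N}(Ind_{Q_{N-1,1}} σ₁', Ind_{Q_{N-1,1}} σ₂') ≠ 0 ⇒ σ₁' = σ₂'` when the cross exponents differ

Topic `NumberTheory/Automorphic/Zelevinsky1980`; theorems only (no definition, no named fact).  Let `F` be a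
non-archimedean local field, `P = Q_{N-1,1} ≤ GL_N(F)` (`N = n + 2`), `σ₁', σ₂'` one-dimensional representations of `P`
(on `ℂ`), `σ₁'` smooth and `σ₂'` trivial on the unipotent radical `U`, `Iᵢ = Ind_P^{GL_N} σᵢ'` (`Representation.smoothIndRep`),
`ϖ` a uniformizer, `d(ϖ) = diag(1,…,1,ϖ)`, `d₀(ϖ) = diag(ϖ,1,…,1)`.

* `eq_of_intertwiningMap_ne_zero` — **if `q_F · σ₁'(d₀(ϖ)) ≠ σ₂'(d(ϖ))` (the OPEN-orbit exponent of `I₁` differs from the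
  CLOSED-orbit exponent of `I₂`), then every NON-ZERO intertwining operator `T : I₁ → I₂` forces `σ₁' = σ₂'`.**  Proof = the
  proof of `exists_intertwiningMap_eq_smul` (`InducedMaximalParabolicEndomorphisms`, the case `σ₁' = σ₂'`) for two characters:
  `λ f = (T f)(1)` is `(P, σ₂')`-equivariant, factors through the `U`-coinvariants of `I₁`, where `d(ϖ)` acts on the
  open-cell classes by `q_F σ₁'(d₀(ϖ))` (`mk_smoothIndRep_diag_eq_smul_of_mem_vanishingOn`), so `λ` kills `I_{1,open}`, hence
  (chart decomposition `exists_sum_smoothIndRep_swap_of_forall_toFun_eq_zero`) every `f` vanishing on `P`, hence `λ = c · ev₁`;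
  `T ≠ 0` gives `c ≠ 0` and an `f` with `f(1) ≠ 0`, and then `σ₂'(p) = σ₁'(p)` from `λ(p·f) = σ₂'(p) λ(f) = c σ₁'(p) f(1)`.
  This is the Mackey/Bruhat computation `Hom_P(I₁|_P, σ₂') ⊆ Hom(σ₁', σ₂') ⊕ Hom(i∘w∘r(σ₁'), σ₂')` of Bernstein–Zelevinsky
  (1977, Thm. 5.2, §7.1: the closed orbit contributes `σ₁'`, the open orbit `i ∘ w ∘ r(σ₁')`, which has no `σ₂'`-quotient when
  the exponents differ).
* `ne_of_detCharDatum_cross` — for the inducing data of `(ν₁ ∘ det) × χ₁′` and `(ν₂ ∘ det) × χ₂′` with UNITARY characters and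
  `N ≥ 3` the hypothesis holds for EVERY uniformizer (norms `√q_F ≠ √q_F^{n+1}`, `DetCharInducingDatum`);
* `eq_of_detCharDatum_eq` — equal inducing data have equal parameters: `(ν₁, χ₁′) = (ν₂, χ₂′)` (values at `d₀(t)`, `d(t)`);
* `eq_of_intertwiningMap_parabolicIndGL_detChar_ne_zero`, `eq_of_areIsomorphicRep_parabolicIndGL_detChar` — **for `N ≥ 3` and
  unitary continuous `νᵢ, χᵢ′`: a non-zero intertwiner, resp. an isomorphism (`Liu2021.AreIsomorphicRep`), between
  `(ν₁ ∘ det) × χ₁′` and `(ν₂ ∘ det) × χ₂′` forces `ν₁ = ν₂` and `χ₁′ = χ₂′`** — uniqueness of the inducing datum of these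
  irreducible (Zelevinsky 1980, Thm. 4.2 / `UnitaryCharacterInductionRegular`) representations, i.e. of their cuspidal support
  (Zelevinsky 1980, Thm. 6.1 / Mínguez 2008 §6 in the type II theta context).  Consumer: cell hodgecm-mathlib, row IV-4c4
  `rankOne_theta_twist_rigidity_split` (two rank-one theta lifts at a split place with isomorphic, hence equal, split-place models).

## References

* I. N. Bernstein, A. V. Zelevinsky, *Induced representations of reductive `p`-adic groups I*, Ann. Sci. ÉNS 10 (1977), Thm. 5.2,
  §7.1. [BernsteinZelevinskyASENS1977]
* A. V. Zelevinsky, *Induced representations of reductive `p`-adic groups II*, Ann. Sci. ÉNS 13 (1980), Thm. 4.2, Thm. 6.1.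
  [Zelevinsky1980]
-/

noncomputable section

open Matrix Literature.LinearAlgebra.Matrix.DiagonalTorus

namespace Literature.NumberTheory.Automorphic.Zelevinsky1980

open Literature.NumberTheory.Automorphic ValuativeRel Valued

section Generic

variable {F : Type*} [Field F] [ValuativeRel F] [TopologicalSpace F] [IsNonarchimedeanLocalField F]
  {n : ℕ} (σ₁ σ₂ : Representation ℂ ↥(standardParabolicGL F (lastBlockLabel (n + 2))) ℂ)

/-- **Rigidity of the inducing character.** Let `σ₁', σ₂'` be one-dimensional representations of `P = Q_{N-1,1}`
(`N = n + 2`), `σ₁'` smooth, `σ₂'` trivial on the unipotent radical, and `ϖ` a uniformizer with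
`q_F · σ₁'(d₀(ϖ)) ≠ σ₂'(d(ϖ))`.  If there is an intertwining operator `T : Ind_P^{GL_N} σ₁' → Ind_P^{GL_N} σ₂'` with `T ≠ 0`,
then `σ₁' = σ₂'`. [cite: BernsteinZelevinskyASENS1977, Thm. 5.2 and §7.1] -/
theorem eq_of_intertwiningMap_ne_zero (hσ₁ : σ₁.IsSmooth)
    (hU₂ : ∀ u : ↥(standardParabolicGL F (lastBlockLabel (n + 2))), u ∈ unipotentRadicalP F (lastBlockLabel (n + 2)) →
      σ₂ u = 1)
    {ϖ : F} (hϖ : IsUniformizingElement ϖ)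
    (hne : (GaloisRepresentations.IsNonarchimedeanLocalField.residueFieldCard F : ℂ) *
        σ₁ ⟨diagGL (Fin (n + 2)) (Function.update 1 0 (Units.mk0 ϖ hϖ.ne_zero)), diagGL_mem_standardParabolicGL _ _⟩ 1 ≠
      σ₂ ⟨diagGL (Fin (n + 2)) (Function.update 1 (Fin.last (n + 1)) (Units.mk0 ϖ hϖ.ne_zero)),
        diagGL_mem_standardParabolicGL _ _⟩ 1)
    (T : (Representation.smoothIndRep (standardParabolicGL F (lastBlockLabel (n + 2))) σ₁).IntertwiningMap
      (Representation.smoothIndRep (standardParabolicGL F (lastBlockLabel (n + 2))) σ₂))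
    (hT : ∃ f, T f ≠ 0) :
    σ₁ = σ₂ := by
  classical
  -- the functional `λ f = (T f)(1)` and its `(P, σ₂')`-equivariance
  set lam : Representation.SmoothInd (standardParabolicGL F (lastBlockLabel (n + 2))) σ₁ →ₗ[ℂ] ℂ :=
    (LinearMap.proj (1 : GL (Fin (n + 2)) F)) ∘ₗ
      (Representation.SmoothInd.toFunₗ (standardParabolicGL F (lastBlockLabel (n + 2))) σ₂ ∘ₗ T.toLinearMap)
    with hlam_def
  have hlam : ∀ f, lam f = (T f).toFun 1 := fun f => rfl
  have hTg : ∀ (g : GL (Fin (n + 2)) F) (f : Representation.SmoothInd (standardParabolicGL F (lastBlockLabel (n + 2))) σ₁),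
      T ((Representation.smoothIndRep (standardParabolicGL F (lastBlockLabel (n + 2))) σ₁) g f) =
        (Representation.smoothIndRep (standardParabolicGL F (lastBlockLabel (n + 2))) σ₂) g (T f) := fun g f =>
    LinearMap.congr_fun (T.isIntertwining' g) f
  have hTval : ∀ (g : GL (Fin (n + 2)) F) (f : Representation.SmoothInd (standardParabolicGL F (lastBlockLabel (n + 2))) σ₁),
      (T f).toFun g = lam ((Representation.smoothIndRep (standardParabolicGL F (lastBlockLabel (n + 2))) σ₁) g f) := by
    intro g f
    rw [hlam, hTg, Representation.toFun_smoothIndRep_apply, one_mul]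
  have hlamP : ∀ (p : ↥(standardParabolicGL F (lastBlockLabel (n + 2))))
      (f : Representation.SmoothInd (standardParabolicGL F (lastBlockLabel (n + 2))) σ₁),
      lam ((Representation.smoothIndRep (standardParabolicGL F (lastBlockLabel (n + 2))) σ₁) (p : GL (Fin (n + 2)) F) f) =
        σ₂ p 1 * lam f := by
    intro p f
    rw [hlam, hlam, hTg, Representation.toFun_smoothIndRep_apply, one_mul, ← mul_one (p : GL (Fin (n + 2)) F),
      Representation.SmoothInd.toFun_subgroup_mul, apply_eq_mul_apply_one]
  -- `λ` factors through the `U`-coinvariants of `I₁` (`σ₂'` is trivial on `U`)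
  have hlamU : ∀ u : ↥(unipotentRadicalP F (lastBlockLabel (n + 2))),
      lam ∘ₗ (Representation.restrictUnipotentGL F (lastBlockLabel (n + 2))
        (Representation.smoothIndRep (standardParabolicGL F (lastBlockLabel (n + 2))) σ₁)) u = lam := by
    intro u
    ext f
    change lam ((Representation.smoothIndRep (standardParabolicGL F (lastBlockLabel (n + 2))) σ₁)
      ((u : ↥(standardParabolicGL F (lastBlockLabel (n + 2)))) : GL (Fin (n + 2)) F) f) = lam f
    rw [hlamP, hU₂ _ u.2, Module.End.one_apply, one_mul]
  set lamb := Representation.Coinvariants.lift (Representation.restrictUnipotentGL F (lastBlockLabel (n + 2))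
    (Representation.smoothIndRep (standardParabolicGL F (lastBlockLabel (n + 2))) σ₁)) lam hlamU with hlamb_def
  have hlamb : ∀ f, lamb (Representation.Coinvariants.mk _ f) = lam f := fun f =>
    Representation.Coinvariants.lift_mk _ _ _ _
  -- the closed-orbit exponent of `I₂`
  set a : GL (Fin (n + 2)) F := diagGL (Fin (n + 2)) (Function.update 1 (Fin.last (n + 1)) (Units.mk0 ϖ hϖ.ne_zero)) with ha
  have haP : a ∈ standardParabolicGL F (lastBlockLabel (n + 2)) := diagGL_mem_standardParabolicGL _ _
  have hlam_a : ∀ f, lam ((Representation.smoothIndRep (standardParabolicGL F (lastBlockLabel (n + 2))) σ₁) a f) =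
      σ₂ ⟨a, haP⟩ 1 * lam f := fun f => hlamP ⟨a, haP⟩ f
  -- Step 1: `λ` kills the open-cell part of `I₁` (its `d(ϖ)`-exponent there is `q_F σ₁'(d₀(ϖ))`)
  have hopen : ∀ f : Representation.SmoothInd (standardParabolicGL F (lastBlockLabel (n + 2))) σ₁,
      f ∈ vanishingOn (standardParabolicGL F (lastBlockLabel (n + 2))) σ₁ (cellLT (K := F) (lastBlockLabel (n + 2)) Fin.revPerm) →
        lam f = 0 := by
    intro f hf
    have h1 := mk_smoothIndRep_diag_eq_smul_of_mem_vanishingOn σ₁ hσ₁ hϖ (s := σ₁ ⟨diagGL (Fin (n + 2))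
      (Function.update 1 0 (Units.mk0 ϖ hϖ.ne_zero)), diagGL_mem_standardParabolicGL _ _⟩ 1)
      (fun w => by rw [smul_eq_mul]; exact apply_eq_mul_apply_one σ₁ _ w) f hf
    have h2 := congrArg lamb h1
    rw [map_smul, hlamb, hlamb, hlam_a, smul_eq_mul] at h2
    have h3 : ((GaloisRepresentations.IsNonarchimedeanLocalField.residueFieldCard F : ℂ) *
        σ₁ ⟨diagGL (Fin (n + 2)) (Function.update 1 0 (Units.mk0 ϖ hϖ.ne_zero)), diagGL_mem_standardParabolicGL _ _⟩ 1 -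
        σ₂ ⟨a, haP⟩ 1) * lam f = 0 := by
      rw [sub_mul, ← h2, sub_self]
    exact (mul_eq_zero.1 h3).resolve_left (sub_ne_zero.2 hne)
  -- Step 2: `λ` kills every `f` vanishing on `P` (chart decomposition of `I₁`)
  have hclosed : ∀ f : Representation.SmoothInd (standardParabolicGL F (lastBlockLabel (n + 2))) σ₁,
      (∀ p ∈ standardParabolicGL F (lastBlockLabel (n + 2)), f.toFun p = 0) → lam f = 0 := by
    intro f hf
    obtain ⟨fi, hfi, hsum⟩ := exists_sum_smoothIndRep_swap_of_forall_toFun_eq_zero σ₁ f hf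
    rw [hsum, map_sum]
    refine Finset.sum_eq_zero fun i _ => ?_
    have hwP : (permGL (Equiv.swap 0 (Fin.castSucc i)) : GL (Fin (n + 2)) F) ∈ standardParabolicGL F (lastBlockLabel (n + 2)) := by
      refine permGL_mem_standardParabolicGL _ fun j => le_of_eq ?_
      have hfix : Equiv.swap (0 : Fin (n + 2)) (Fin.castSucc i) (Fin.last (n + 1)) = Fin.last (n + 1) :=
        Equiv.swap_apply_of_ne_of_ne (Fin.last_pos'.ne') (Fin.castSucc_lt_last i).ne'
      have key : ∀ j : Fin (n + 2), lastBlockLabel (n + 2) j = decide (j = Fin.last (n + 1)) := by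
        intro j
        simp only [lastBlockLabel, Fin.ext_iff, Fin.val_last]
        by_cases h : (j : ℕ) = n + 1
        · rw [decide_eq_true h, decide_eq_true (by omega)]
        · rw [decide_eq_false h, decide_eq_false (by have := j.2; omega)]
      rw [key, key]
      congr 1
      rw [← hfix, Equiv.apply_eq_iff_eq, hfix]
    rw [hlamP ⟨_, hwP⟩, hopen _ (hfi i), mul_zero]
  -- Step 3: `λ = c · ev₁`
  have hval : ∀ (h : Representation.SmoothInd (standardParabolicGL F (lastBlockLabel (n + 2))) σ₁)
      {p : GL (Fin (n + 2)) F} (hp : p ∈ standardParabolicGL F (lastBlockLabel (n + 2))),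
      h.toFun p = σ₁ ⟨p, hp⟩ 1 * h.toFun 1 := by
    intro h p hp
    rw [← apply_eq_mul_apply_one, ← Representation.SmoothInd.toFun_subgroup_mul, mul_one]
  have hev : ∃ c : ℂ, ∀ f : Representation.SmoothInd (standardParabolicGL F (lastBlockLabel (n + 2))) σ₁,
      lam f = c * f.toFun 1 := by
    by_cases h : ∃ f₁ : Representation.SmoothInd (standardParabolicGL F (lastBlockLabel (n + 2))) σ₁, f₁.toFun 1 ≠ 0
    · obtain ⟨f₁, hf₁⟩ := h
      refine ⟨lam f₁ / f₁.toFun 1, fun f => ?_⟩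
      have hg : ∀ p ∈ standardParabolicGL F (lastBlockLabel (n + 2)),
          (f - (f.toFun 1 / f₁.toFun 1) • f₁).toFun p = 0 := by
        intro p hp
        have e1 : (f - (f.toFun 1 / f₁.toFun 1) • f₁).toFun =
            f.toFun - (f.toFun 1 / f₁.toFun 1) • f₁.toFun := by
          rw [← Representation.SmoothInd.toFunₗ_apply, map_sub, map_smul, Representation.SmoothInd.toFunₗ_apply,
            Representation.SmoothInd.toFunₗ_apply]
        rw [e1, Pi.sub_apply, Pi.smul_apply, smul_eq_mul, hval f hp, hval f₁ hp, ← mul_assoc,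
          mul_comm (f.toFun 1 / f₁.toFun 1), mul_assoc, div_mul_cancel₀ _ hf₁, sub_self]
      have := hclosed _ hg
      rw [map_sub, map_smul, smul_eq_mul, sub_eq_zero] at this
      rw [this, div_mul_eq_mul_div, mul_comm, ← div_mul_eq_mul_div, mul_comm]
    · refine ⟨0, fun f => ?_⟩
      rw [zero_mul]
      refine hclosed f fun p hp => ?_
      rw [hval f hp]
      have h0 : f.toFun 1 = 0 := by
        by_contra h0; exact h ⟨f, h0⟩
      rw [h0, mul_zero]
  obtain ⟨c, hc⟩ := hev
  -- Step 4: `T ≠ 0` gives `c ≠ 0` and a function with `f(1) ≠ 0`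
  obtain ⟨f₀, hf₀⟩ := hT
  obtain ⟨g, hg⟩ : ∃ g : GL (Fin (n + 2)) F, (T f₀).toFun g ≠ 0 := by
    by_contra hall
    push Not at hall
    exact hf₀ (Representation.SmoothInd.ext (funext fun g => by rw [hall g]; rfl))
  rw [hTval, hc] at hg
  have hc0 : c ≠ 0 := fun h0 => hg (by rw [h0, zero_mul])
  have hf1 : ((Representation.smoothIndRep (standardParabolicGL F (lastBlockLabel (n + 2))) σ₁) g f₀).toFun 1 ≠ 0 :=
    fun h0 => hg (by rw [h0, mul_zero])
  set f₁ := (Representation.smoothIndRep (standardParabolicGL F (lastBlockLabel (n + 2))) σ₁) g f₀ with hf₁_def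
  -- Step 5: compare `λ(p · f₁) = σ₂'(p) λ(f₁)` with `λ(p · f₁) = c σ₁'(p) f₁(1)`
  refine MonoidHom.ext fun p => LinearMap.ext fun z => ?_
  have key : σ₁ p 1 = σ₂ p 1 := by
    have e1 := hlamP p f₁
    rw [hc, hc, Representation.toFun_smoothIndRep_apply, one_mul, hval f₁ p.2] at e1
    -- `e1 : c * (σ₁ p 1 * f₁(1)) = σ₂ p 1 * (c * f₁(1))`
    have e2 : (σ₁ ⟨(p : GL (Fin (n + 2)) F), p.2⟩ 1 - σ₂ p 1) * (c * f₁.toFun 1) = 0 := by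
      rw [sub_mul]
      calc σ₁ ⟨(p : GL (Fin (n + 2)) F), p.2⟩ 1 * (c * f₁.toFun 1) - σ₂ p 1 * (c * f₁.toFun 1)
          = c * (σ₁ ⟨(p : GL (Fin (n + 2)) F), p.2⟩ 1 * f₁.toFun 1) - σ₂ p 1 * (c * f₁.toFun 1) := by ring
        _ = 0 := by rw [e1, sub_self]
    have e3 := (mul_eq_zero.1 e2).resolve_right (mul_ne_zero hc0 hf1)
    rwa [sub_eq_zero, Subtype.coe_eta] at e3
  rw [apply_eq_mul_apply_one σ₁, apply_eq_mul_apply_one σ₂, key]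

end Generic

/-! ### The inducing data of `(ν ∘ det) × χ′` -/

section DetChar

variable (F : Type*) [Field F] [ValuativeRel F] [TopologicalSpace F] [IsNonarchimedeanLocalField F] {n : ℕ}
  (ν₁ χ₁ ν₂ χ₂ : Fˣ →* ℂˣ)

/-- **The cross exponents of two unitary data differ for `N ≥ 3`**: `q_F · σ'_{ν₁,χ₁′}(d₀(ϖ)) 1 = ν₁(ϖ) √q_F` and
`σ'_{ν₂,χ₂′}(d(ϖ)) 1 = χ₂′(ϖ) √q_F^{n+1}` have different norms when `n ≥ 1`. [cite: BernsteinZelevinskyASENS1977, §7.1] -/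
theorem ne_of_detCharDatum_cross (hn : 1 ≤ n) (hν₁u : ∀ x, ‖((ν₁ x : ℂˣ) : ℂ)‖ = 1) (hχ₂u : ∀ x, ‖((χ₂ x : ℂˣ) : ℂ)‖ = 1)
    {ϖ : F} (hϖ : IsUniformizingElement ϖ) :
    (GaloisRepresentations.IsNonarchimedeanLocalField.residueFieldCard F : ℂ) *
      Representation.twist (((Representation.trivial ℂ (Π a : Bool, GL {i : Fin (n + 2) // lastBlockLabel (n + 2) i = a} F) ℂ).twist
        (maxParabolicLeviChar F (n + 2) ν₁ χ₁)).comp (leviProjection F (lastBlockLabel (n + 2))))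
      (rootDeltaChar (standardParabolicGL F (lastBlockLabel (n + 2))))
      ⟨diagGL (Fin (n + 2)) (Function.update 1 0 (Units.mk0 ϖ hϖ.ne_zero)), diagGL_mem_standardParabolicGL _ _⟩ 1 ≠
    Representation.twist (((Representation.trivial ℂ (Π a : Bool, GL {i : Fin (n + 2) // lastBlockLabel (n + 2) i = a} F) ℂ).twist
        (maxParabolicLeviChar F (n + 2) ν₂ χ₂)).comp (leviProjection F (lastBlockLabel (n + 2))))
      (rootDeltaChar (standardParabolicGL F (lastBlockLabel (n + 2))))
      ⟨diagGL (Fin (n + 2)) (Function.update 1 (Fin.last (n + 1)) (Units.mk0 ϖ hϖ.ne_zero)),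
        diagGL_mem_standardParabolicGL _ _⟩ 1 := by
  rw [residueFieldCard_mul_detCharDatum_diag_zero_uniformizer F ν₁ χ₁ hϖ, detCharDatum_diag_last_uniformizer F ν₂ χ₂ hϖ]
  intro h
  have hs : 1 < Real.sqrt (GaloisRepresentations.IsNonarchimedeanLocalField.residueFieldCard F : ℝ) := by
    rw [Real.lt_sqrt zero_le_one, one_pow]
    exact_mod_cast GaloisRepresentations.IsNonarchimedeanLocalField.one_lt_residueFieldCard F
  have h' := congrArg (fun z : ℂ => ‖z‖) h
  simp only [norm_mul, norm_pow, Complex.norm_real, Real.norm_eq_abs, hν₁u, hχ₂u, one_mul,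
    abs_of_pos (zero_lt_one.trans hs)] at h'
  have hlt : Real.sqrt (GaloisRepresentations.IsNonarchimedeanLocalField.residueFieldCard F : ℝ) ^ 1 <
      Real.sqrt (GaloisRepresentations.IsNonarchimedeanLocalField.residueFieldCard F : ℝ) ^ (n + 1) :=
    pow_lt_pow_right₀ hs (by omega)
  rw [pow_one] at hlt
  exact hlt.ne h'

/-- **Equal inducing data have equal parameters**: if the characters `σ'_{ν₁,χ₁′} = σ'_{ν₂,χ₂′}` of `Q_{N-1,1}` (`N = n + 2`)
coincide then `ν₁ = ν₂` (values at `d₀(t)`) and `χ₁′ = χ₂′` (values at `d(t)`). [cite: Zelevinsky1980, §3.2, p. 181] -/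
theorem eq_of_detCharDatum_eq
    (h : Representation.twist (((Representation.trivial ℂ (Π a : Bool, GL {i : Fin (n + 2) // lastBlockLabel (n + 2) i = a} F) ℂ).twist
        (maxParabolicLeviChar F (n + 2) ν₁ χ₁)).comp (leviProjection F (lastBlockLabel (n + 2))))
      (rootDeltaChar (standardParabolicGL F (lastBlockLabel (n + 2)))) =
      Representation.twist (((Representation.trivial ℂ (Π a : Bool, GL {i : Fin (n + 2) // lastBlockLabel (n + 2) i = a} F) ℂ).twist
        (maxParabolicLeviChar F (n + 2) ν₂ χ₂)).comp (leviProjection F (lastBlockLabel (n + 2))))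
      (rootDeltaChar (standardParabolicGL F (lastBlockLabel (n + 2))))) :
    ν₁ = ν₂ ∧ χ₁ = χ₂ := by
  have hδ : ∀ p : ↥(standardParabolicGL F (lastBlockLabel (n + 2))),
      ((rootDeltaChar (standardParabolicGL F (lastBlockLabel (n + 2))) p : ℂˣ) : ℂ) ≠ 0 := fun p => Units.ne_zero _
  constructor
  · ext t
    have e := congrArg (fun σ => σ ⟨diagGL (Fin (n + 2)) (Function.update 1 0 t), diagGL_mem_standardParabolicGL _ _⟩ (1 : ℂ)) h
    simp only [detCharDatum_apply, maxParabolicLeviChar_leviProjection_diag_zero, mul_one] at e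
    exact mul_left_cancel₀ (hδ _) e
  · ext t
    have e := congrArg (fun σ => σ ⟨diagGL (Fin (n + 2)) (Function.update 1 (Fin.last (n + 1)) t),
      diagGL_mem_standardParabolicGL _ _⟩ (1 : ℂ)) h
    simp only [detCharDatum_apply, maxParabolicLeviChar_leviProjection_diag_last, mul_one] at e
    exact mul_left_cancel₀ (hδ _) e

/-- **A non-zero intertwiner between `(ν₁ ∘ det) × χ₁′` and `(ν₂ ∘ det) × χ₂′` forces `(ν₁, χ₁′) = (ν₂, χ₂′)`** for `N ≥ 3`
(`N = n + 2`, `n ≥ 1`) and unitary continuous characters (continuity of `ν₁, χ₁′` for the smoothness of the source datum).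
[cite: Zelevinsky1980, Thm. 4.2 and Thm. 6.1] -/
theorem eq_of_intertwiningMap_parabolicIndGL_detChar_ne_zero (hn : 1 ≤ n)
    [LocallyCompactSpace (standardParabolicGL F (lastBlockLabel (n + 2)))]
    (hν₁u : ∀ x, ‖((ν₁ x : ℂˣ) : ℂ)‖ = 1) (hν₁c : Continuous fun x => ((ν₁ x : ℂˣ) : ℂ))
    (hχ₁c : Continuous fun x => ((χ₁ x : ℂˣ) : ℂ)) (hχ₂u : ∀ x, ‖((χ₂ x : ℂˣ) : ℂ)‖ = 1)
    (T : (Representation.parabolicIndGL F (lastBlockLabel (n + 2))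
        ((Representation.trivial ℂ (Π a : Bool, GL {i : Fin (n + 2) // lastBlockLabel (n + 2) i = a} F) ℂ).twist
          (maxParabolicLeviChar F (n + 2) ν₁ χ₁))).IntertwiningMap
      (Representation.parabolicIndGL F (lastBlockLabel (n + 2))
        ((Representation.trivial ℂ (Π a : Bool, GL {i : Fin (n + 2) // lastBlockLabel (n + 2) i = a} F) ℂ).twist
          (maxParabolicLeviChar F (n + 2) ν₂ χ₂))))
    (hT : ∃ f, T f ≠ 0) :
    ν₁ = ν₂ ∧ χ₁ = χ₂ := by
  obtain ⟨ϖ, hϖ⟩ := exists_isUniformizingElement (F := F)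
  exact eq_of_detCharDatum_eq F ν₁ χ₁ ν₂ χ₂
    (eq_of_intertwiningMap_ne_zero _ _ (detCharDatum_isSmooth F (n + 2) ν₁ χ₁ hν₁c hχ₁c)
      (fun u hu => detCharDatum_eq_one_of_mem_unipotentRadicalP F (n + 2) ν₂ χ₂ u hu) hϖ
      (ne_of_detCharDatum_cross F ν₁ χ₁ ν₂ χ₂ hn hν₁u hχ₂u hϖ) T hT)

/-- **Isomorphic `(ν₁ ∘ det) × χ₁′ ≅ (ν₂ ∘ det) × χ₂′` forces `(ν₁, χ₁′) = (ν₂, χ₂′)`** (`N = n + 2 ≥ 3`, unitary continuous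
characters; `Liu2021.AreIsomorphicRep`): the isomorphism is a non-zero intertwiner because the induced space is non-zero
(`nontrivial_parabolicIndGL_detChar`). [cite: Zelevinsky1980, Thm. 4.2 and Thm. 6.1] -/
theorem eq_of_areIsomorphicRep_parabolicIndGL_detChar (hn : 1 ≤ n)
    [LocallyCompactSpace (standardParabolicGL F (lastBlockLabel (n + 2)))]
    (hν₁u : ∀ x, ‖((ν₁ x : ℂˣ) : ℂ)‖ = 1) (hν₁c : Continuous fun x => ((ν₁ x : ℂˣ) : ℂ))
    (hχ₁c : Continuous fun x => ((χ₁ x : ℂˣ) : ℂ)) (hχ₂u : ∀ x, ‖((χ₂ x : ℂˣ) : ℂ)‖ = 1)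
    (h : Liu2021.AreIsomorphicRep
      (Representation.parabolicIndGL F (lastBlockLabel (n + 2))
        ((Representation.trivial ℂ (Π a : Bool, GL {i : Fin (n + 2) // lastBlockLabel (n + 2) i = a} F) ℂ).twist
          (maxParabolicLeviChar F (n + 2) ν₁ χ₁)))
      (Representation.parabolicIndGL F (lastBlockLabel (n + 2))
        ((Representation.trivial ℂ (Π a : Bool, GL {i : Fin (n + 2) // lastBlockLabel (n + 2) i = a} F) ℂ).twist
          (maxParabolicLeviChar F (n + 2) ν₂ χ₂)))) :
    ν₁ = ν₂ ∧ χ₁ = χ₂ := by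
  obtain ⟨e⟩ := h.nonempty_equiv
  haveI := nontrivial_parabolicIndGL_detChar F (n + 2) ν₁ χ₁ hν₁c hχ₁c
  obtain ⟨f, hf⟩ := exists_ne
    (0 : Representation.SmoothInd (standardParabolicGL F (lastBlockLabel (n + 2)))
      (Representation.twist (((Representation.trivial ℂ (Π a : Bool, GL {i : Fin (n + 2) // lastBlockLabel (n + 2) i = a} F) ℂ).twist
        (maxParabolicLeviChar F (n + 2) ν₁ χ₁)).comp (leviProjection F (lastBlockLabel (n + 2))))
        (rootDeltaChar (standardParabolicGL F (lastBlockLabel (n + 2))))))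
  refine eq_of_intertwiningMap_parabolicIndGL_detChar_ne_zero F ν₁ χ₁ ν₂ χ₂ hn hν₁u hν₁c hχ₁c hχ₂u e.toIntertwiningMap
    ⟨f, fun h0 => hf ?_⟩
  have : e.toLinearEquiv f = 0 := h0
  exact e.toLinearEquiv.map_eq_zero_iff.1 this

end DetChar

end Literature.NumberTheory.Automorphic.Zelevinsky1980

end
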